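import Literature.Analysis.UnboundedOperators.HeatKernel
import Mathlib.MeasureTheory.Measure.Haar.Unique
import Mathlib.Analysis.InnerProductSpace.Calculus
import Mathlib.Analysis.Calculus.ParametricIntegral
import Mathlib.MeasureTheory.Function.LpSeminorm.CompareExp
import HarnessLib

/-!
# The gradient of the caloric extension: `‖∇e^{tΔ} f‖_p ≤ C t^{-1/2} ‖f‖_p` (discharge)

Sibling proof file of `HeatKernel.lean` (D-0014: named facts `def X : Prop` are discharged as
`theorem X_holds : X`). It discharges

* `Literature.eLpNorm_fderiv_heatExtension_le_holds : eLpNorm_fderiv_heatExtension_le E F` — for a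
  finite-dimensional real inner product space `E` (`n = finrank ℝ E`), a real Banach space `F`,
  `1 ≤ p ≤ ∞`, `f ∈ L^p(E, F)` and `0 < t`,
  `‖∇(e^{tΔ} f)‖_p ≤ 2^{n/2} t^{-1/2} ‖f‖_p`, i.e. the fact holds with `C = 2^{n/2}`.

This is the case `|α| = 1`, `q = p` of the derivative `L^p`–`L^q` estimates for the heat semigroup
in Giga–Giga–Saal, *Nonlinear Partial Differential Equations* (2010), §1.1.3, proved there from
the explicit Gauss kernel `G_t` and Young's inequality: `∂ e^{tΔ} f = (∂G_t) ⋆ f`, and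
`‖∂G_t‖₁ = t^{-1/2} ‖∂G_1‖₁` by scaling.

## Proof architecture (as formalised)

1. `hasFDerivAt_heatKernel`: `∇G_t(x) = -(G_t(x)/(2t)) x` (chain rule on
   `(4πt)^{-n/2} exp(-‖x‖²/(4t))`), hence `‖∇G_t(x)‖ = G_t(x)‖x‖/(2t)`.
2. `norm_fderiv_heatKernel_le`: `‖∇G_t(x)‖ ≤ (4πt)^{-n/2} t^{-1/2} exp(-‖x‖²/(8t))`, from the
   elementary `exp(-a²/(8t)) a/(2t) ≤ t^{-1/2}` (`u/2 ≤ 1 + u²/8 ≤ exp(u²/8)` with `u = a/√t`);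
   integrating the Gaussian (`GaussianFourier.integral_rexp_neg_mul_sq_norm`) gives
   `lintegral_enorm_fderiv_heatKernel_le : ‖∇G_t‖₁ ≤ 2^{n/2} t^{-1/2}` (in place of the exact
   scaling identity of the source; the constant is immaterial for the fact).
3. `hasFDerivAt_heatExtension`: differentiation under the integral sign
   (`hasFDerivAt_integral_of_dominated_of_fderiv_le`) for `x ↦ ∫ G_t(x - y) f(y) dy` on the unit
   ball around `x₀`; the dominating function is a Gaussian centred at `x₀` times `‖f‖`, which is
   integrable by Hölder's inequality since Gaussians lie in every `L^q`
   (`memLp_gaussian_of_pos`, `integrable_gaussian_smul_of_memLp`).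
4. Pointwise `‖∇(e^{tΔ}f)(x)‖ ≤ (‖∇G_t‖ ⋆ ‖f‖)(x)` (`norm_fderiv_heatExtension_le`), then Young's
   inequality `L¹ × Lᵖ → Lᵖ` from `HeatKernel.lean`
   (`Literature.Analysis.UnboundedOperators.eLpNorm_convolution_le_lintegral_enorm_mul`) and step 2.

## Sources

* M.-H. Giga, Y. Giga, J. Saal, *Nonlinear Partial Differential Equations. Asymptotic Behavior of
  Solutions and Self-Similar Solutions*, Birkhäuser (2010), §1.1.3 (derivative estimates for
  `e^{tΔ}`), §1.1.2 (`L^p`–`L^q` estimates, Young's inequality).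
* L. C. Evans, *Partial Differential Equations*, 2nd ed. (2010), §2.3.1 (the fundamental solution
  and its derivatives).
-/

open MeasureTheory Filter Topology
open scoped Real ENNReal NNReal Convolution

noncomputable section

namespace Literature.Analysis.UnboundedOperators

/-! ### The gradient of the Gauss–Weierstrass kernel -/

section Kernel

variable {E : Type*} [NormedAddCommGroup E] [InnerProductSpace ℝ E]

/-- The gradient of the Gauss–Weierstrass kernel: `∇G_t(x) = -(G_t(x)/(2t)) x`, stated as a
Fréchet derivative (`innerSL ℝ x = ⟪x, ·⟫`). It holds for every real `t` thanks to the junk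
convention `a / 0 = 0`. Evans, *PDE*, §2.3.1. [folklore] -/
theorem hasFDerivAt_heatKernel (t : ℝ) (x : E) :
    HasFDerivAt (heatKernel (E := E) t) ((-(heatKernel t x / (2 * t))) • innerSL ℝ x) x := by
  have h1 : HasFDerivAt (fun x : E => ‖x‖ ^ 2) ((2 : ℕ) • innerSL ℝ x) x :=
    (hasStrictFDerivAt_norm_sq x).hasFDerivAt
  have h2 := ((h1.const_mul (-(1 / (4 * t)))).exp).const_mul
    ((4 * π * t) ^ (-(Module.finrank ℝ E : ℝ) / 2))
  have heq : heatKernel (E := E) t = fun x => (4 * π * t) ^ (-(Module.finrank ℝ E : ℝ) / 2) *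
      Real.exp (-(1 / (4 * t)) * ‖x‖ ^ 2) := funext (heatKernel_eq t)
  rw [heq]
  refine h2.congr_fderiv ?_
  rw [← Nat.cast_smul_eq_nsmul ℝ, smul_smul, smul_smul, smul_smul]
  congr 1
  dsimp only
  rcases eq_or_ne t 0 with rfl | ht
  · simp
  · push_cast
    field_simp
    ring

/-- The gradient of the Gauss–Weierstrass kernel is continuous. Evans, *PDE*, §2.3.1. [folklore] -/
theorem continuous_fderiv_heatKernel (t : ℝ) : Continuous (fderiv ℝ (heatKernel (E := E) t)) := by
  have : fderiv ℝ (heatKernel (E := E) t) =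
      fun x => (-(heatKernel t x / (2 * t))) • innerSL ℝ x :=
    funext fun x => (hasFDerivAt_heatKernel t x).fderiv
  rw [this]
  exact ((continuous_heatKernel t).div_const _).neg.smul (innerSL ℝ (E := E)).continuous

/-- `‖∇G_t(x)‖ = G_t(x) ‖x‖ / (2t)` for `0 < t`. Evans, *PDE*, §2.3.1. [folklore] -/
theorem norm_fderiv_heatKernel {t : ℝ} (ht : 0 < t) (x : E) :
    ‖fderiv ℝ (heatKernel t) x‖ = heatKernel t x / (2 * t) * ‖x‖ := by
  rw [(hasFDerivAt_heatKernel t x).fderiv, norm_smul, innerSL_apply_norm, norm_neg,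
    Real.norm_of_nonneg (div_pos (heatKernel_pos ht x) (by positivity)).le]

/-- Elementary inequality behind `‖∇G_t‖₁ ≲ t^{-1/2}`:
`exp (-a²/(8t)) · a/(2t) ≤ 1/√t` for real `a` and `t > 0` (from `a/(2√t) ≤ 1 + a²/(8t) ≤ exp (a²/(8t))`).
[folklore] -/
theorem exp_neg_sq_mul_div_le {t : ℝ} (ht : 0 < t) (a : ℝ) :
    Real.exp (-(1 / (8 * t)) * a ^ 2) * (a / (2 * t)) ≤ (Real.sqrt t)⁻¹ := by
  set s := Real.sqrt t with hs
  have hs0 : 0 < s := Real.sqrt_pos.2 ht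
  have hst : s ^ 2 = t := Real.sq_sqrt ht.le
  have h3 : a / (2 * t) ≤ s⁻¹ * ((1 / (8 * t)) * a ^ 2 + 1) := by
    rw [← hst, div_le_iff₀ (by positivity)]
    have : s⁻¹ * (1 / (8 * s ^ 2) * a ^ 2 + 1) * (2 * s ^ 2) = (a ^ 2 / 4 + 2 * s ^ 2) / s := by
      field_simp
      ring
    rw [this, le_div_iff₀ hs0]
    nlinarith [sq_nonneg (a - 2 * s)]
  have h4 : (1 / (8 * t)) * a ^ 2 + 1 ≤ Real.exp ((1 / (8 * t)) * a ^ 2) := Real.add_one_le_exp _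
  calc Real.exp (-(1 / (8 * t)) * a ^ 2) * (a / (2 * t))
      ≤ Real.exp (-(1 / (8 * t)) * a ^ 2) * (s⁻¹ * Real.exp ((1 / (8 * t)) * a ^ 2)) := by
        gcongr
        exact h3.trans (by gcongr)
    _ = s⁻¹ := by
        rw [neg_mul, Real.exp_neg, mul_left_comm, inv_mul_cancel₀ (Real.exp_pos _).ne', mul_one]

/-- Gaussian bound on the gradient of the heat kernel:
`‖∇G_t(x)‖ ≤ (4πt)^{-n/2} t^{-1/2} exp (-‖x‖²/(8t))` for `0 < t`. [folklore] -/
theorem norm_fderiv_heatKernel_le {t : ℝ} (ht : 0 < t) (x : E) :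
    ‖fderiv ℝ (heatKernel t) x‖ ≤
      (4 * π * t) ^ (-(Module.finrank ℝ E : ℝ) / 2) * (Real.sqrt t)⁻¹ *
        Real.exp (-(1 / (8 * t)) * ‖x‖ ^ 2) := by
  rw [norm_fderiv_heatKernel ht, heatKernel_eq]
  have hsplit : Real.exp (-(1 / (4 * t)) * ‖x‖ ^ 2) =
      Real.exp (-(1 / (8 * t)) * ‖x‖ ^ 2) * Real.exp (-(1 / (8 * t)) * ‖x‖ ^ 2) := by
    rw [← Real.exp_add]
    congr 1
    ring
  have key := exp_neg_sq_mul_div_le ht ‖x‖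
  have hc : 0 ≤ (4 * π * t) ^ (-(Module.finrank ℝ E : ℝ) / 2) := by positivity
  calc (4 * π * t) ^ (-(Module.finrank ℝ E : ℝ) / 2) * Real.exp (-(1 / (4 * t)) * ‖x‖ ^ 2) /
        (2 * t) * ‖x‖
      = (4 * π * t) ^ (-(Module.finrank ℝ E : ℝ) / 2) *
          (Real.exp (-(1 / (8 * t)) * ‖x‖ ^ 2) * (‖x‖ / (2 * t))) *
          Real.exp (-(1 / (8 * t)) * ‖x‖ ^ 2) := by
        rw [hsplit]; ring
    _ ≤ (4 * π * t) ^ (-(Module.finrank ℝ E : ℝ) / 2) * (Real.sqrt t)⁻¹ *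
          Real.exp (-(1 / (8 * t)) * ‖x‖ ^ 2) := by
        gcongr

variable [FiniteDimensional ℝ E] [MeasurableSpace E] [BorelSpace E]

/-- Real Gaussians `exp (-b‖x‖²)`, `b > 0`, are integrable on a finite-dimensional inner product
space (from the value of the Gaussian integral, `GaussianFourier.integral_rexp_neg_mul_sq_norm`).
[folklore] -/
theorem integrable_gaussian_of_pos {b : ℝ} (hb : 0 < b) :
    Integrable (fun x : E => Real.exp (-b * ‖x‖ ^ 2)) := by
  by_contra h
  have h1 := GaussianFourier.integral_rexp_neg_mul_sq_norm (V := E) hb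
  rw [integral_undef h] at h1
  have : 0 < (π / b) ^ ((Module.finrank ℝ E : ℝ) / 2) := by positivity
  exact this.ne h1

/-- Real Gaussians `exp (-b‖x‖²)`, `b > 0`, lie in every `L^q`, `0 ≤ q ≤ ∞` (bounded by `1`, and
`|exp (-b‖x‖²)|^q = exp (-bq‖x‖²)` is integrable). [folklore] -/
theorem memLp_gaussian_of_pos {b : ℝ} (hb : 0 < b) (q : ℝ≥0∞) :
    MemLp (fun x : E => Real.exp (-b * ‖x‖ ^ 2)) q volume := by
  have hcont : Continuous (fun x : E => Real.exp (-b * ‖x‖ ^ 2)) := by fun_prop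
  have hmeas : AEStronglyMeasurable (fun x : E => Real.exp (-b * ‖x‖ ^ 2)) volume :=
    hcont.aestronglyMeasurable
  rcases eq_or_ne q ∞ with rfl | hqtop
  · refine memLp_top_of_bound hmeas 1 (Eventually.of_forall fun x => ?_)
    rw [Real.norm_of_nonneg (Real.exp_nonneg _), Real.exp_le_one_iff]
    have : 0 ≤ b * ‖x‖ ^ 2 := by positivity
    linarith
  rcases eq_or_ne q 0 with rfl | hq0
  · exact memLp_zero_iff_aestronglyMeasurable.2 hmeas
  rw [← integrable_norm_rpow_iff hmeas hq0 hqtop]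
  have hq : 0 < q.toReal := ENNReal.toReal_pos hq0 hqtop
  have : (fun x : E => ‖Real.exp (-b * ‖x‖ ^ 2)‖ ^ q.toReal) =
      fun x => Real.exp (-(b * q.toReal) * ‖x‖ ^ 2) := by
    funext x
    rw [Real.norm_of_nonneg (Real.exp_nonneg _), ← Real.exp_mul]
    congr 1
    ring
  rw [this]
  exact integrable_gaussian_of_pos (mul_pos hb hq)

/-- `‖∇G_t‖₁ ≤ 2^{n/2} t^{-1/2}` for `0 < t` (`n = finrank ℝ E`): integrate the Gaussian bound
`norm_fderiv_heatKernel_le`, using `∫ exp(-‖x‖²/(8t)) dx = (8πt)^{n/2}`. This replaces the exact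
scaling identity `‖∇G_t‖₁ = t^{-1/2}‖∇G_1‖₁` of Giga–Giga–Saal, *Nonlinear PDEs*, §1.1.3.
[cite: GigaGigaSaal2010, §1.1.3] -/
theorem lintegral_enorm_fderiv_heatKernel_le {t : ℝ} (ht : 0 < t) :
    ∫⁻ x, ‖fderiv ℝ (heatKernel (E := E) t) x‖ₑ ≤
      ENNReal.ofReal ((2 : ℝ) ^ ((Module.finrank ℝ E : ℝ) / 2) * t ^ (-(1 / 2 : ℝ))) := by
  set n : ℝ := (Module.finrank ℝ E : ℝ) with hn
  set c : ℝ := (4 * π * t) ^ (-n / 2) * (Real.sqrt t)⁻¹ with hc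
  have hc0 : 0 ≤ c := by positivity
  have hb : 0 < 1 / (8 * t) := by positivity
  have hint : Integrable (fun x : E => c * Real.exp (-(1 / (8 * t)) * ‖x‖ ^ 2)) :=
    (integrable_gaussian_of_pos hb).const_mul c
  calc ∫⁻ x, ‖fderiv ℝ (heatKernel (E := E) t) x‖ₑ
      ≤ ∫⁻ x, ENNReal.ofReal (c * Real.exp (-(1 / (8 * t)) * ‖(x : E)‖ ^ 2)) := by
        refine lintegral_mono fun x => ?_
        rw [← ofReal_norm]
        exact ENNReal.ofReal_le_ofReal (norm_fderiv_heatKernel_le ht x)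
    _ = ENNReal.ofReal (∫ x, c * Real.exp (-(1 / (8 * t)) * ‖(x : E)‖ ^ 2)) := by
        rw [ofReal_integral_eq_lintegral_ofReal hint
          (Eventually.of_forall fun x => by positivity)]
    _ = ENNReal.ofReal ((2 : ℝ) ^ (n / 2) * t ^ (-(1 / 2 : ℝ))) := by
        congr 1
        rw [integral_const_mul, GaussianFourier.integral_rexp_neg_mul_sq_norm hb, hc, ← hn]
        have h8 : π / (1 / (8 * t)) = 2 * (4 * π * t) := by
          field_simp
          norm_num
        have hpos : 0 < (4 * π * t) ^ (n / 2) := by positivity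
        have hid : (4 * π * t) ^ (-n / 2) * (π / (1 / (8 * t))) ^ (n / 2) = 2 ^ (n / 2) := by
          rw [h8, Real.mul_rpow (x := 2) (by norm_num) (by positivity), neg_div,
            Real.rpow_neg (by positivity), mul_comm ((2 : ℝ) ^ (n / 2)), ← mul_assoc,
            inv_mul_cancel₀ hpos.ne', one_mul]
        rw [mul_right_comm, hid, Real.sqrt_eq_rpow, ← Real.rpow_neg ht.le]

end Kernel

/-! ### The gradient of the caloric extension -/

section Extension

variable {E : Type*} [NormedAddCommGroup E] [InnerProductSpace ℝ E] [FiniteDimensional ℝ E]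
  [MeasurableSpace E] [BorelSpace E]
  {F : Type*} [NormedAddCommGroup F] [NormedSpace ℝ F]

/-- For `1 ≤ p ≤ ∞`, the exponent `(1 - p⁻¹)⁻¹` is Hölder conjugate to `p`
(`(1 - p⁻¹) + p⁻¹ = 1` in `ℝ≥0∞`). [folklore] -/
theorem holderTriple_conj_of_one_le {p : ℝ≥0∞} (hp : 1 ≤ p) :
    ENNReal.HolderTriple (1 - p⁻¹)⁻¹ p 1 :=
  ⟨by rw [inv_inv, inv_one, tsub_add_cancel_of_le (ENNReal.inv_le_one.2 hp)]⟩

/-- A translated Gaussian times an `L^p` function (`1 ≤ p ≤ ∞`) is integrable: Hölder's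
inequality, the Gaussian lying in the conjugate Lebesgue space (`memLp_gaussian_of_pos` and
translation invariance of Lebesgue measure). [folklore] -/
theorem integrable_gaussian_smul_of_memLp {G' : Type*} [NormedAddCommGroup G'] [NormedSpace ℝ G']
    {b : ℝ} (hb : 0 < b) (x₀ : E) {g : E → G'} {p : ℝ≥0∞} (hg : MemLp g p volume) (hp : 1 ≤ p) :
    Integrable (fun y => Real.exp (-b * ‖x₀ - y‖ ^ 2) • g y) := by
  have := holderTriple_conj_of_one_le hp
  have hG : MemLp (fun y : E => Real.exp (-b * ‖x₀ - y‖ ^ 2)) (1 - p⁻¹)⁻¹ volume :=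
    (memLp_gaussian_of_pos hb _).comp_measurePreserving
      (Measure.measurePreserving_sub_left volume x₀)
  exact memLp_one_iff_integrable.1 (hg.smul hG)

/-- **Differentiation under the convolution integral.** For `f ∈ L^p(E, F)`, `1 ≤ p ≤ ∞`, `F`
complete and `0 < t`, the caloric extension `e^{tΔ} f = G_t ⋆ f` is Fréchet differentiable at
every point `x₀`, with derivative `∫ ∇G_t(x₀ - y) ⊗ f(y) dy` (the rank-one operators
`h ↦ ⟪∇G_t(x₀ - y), h⟫ f(y)`). Dominated differentiation on the unit ball around `x₀`
(`hasFDerivAt_integral_of_dominated_of_fderiv_le`): by `norm_fderiv_heatKernel_le` and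
`‖x₀ - y‖² ≤ 2‖x - y‖² + 2` for `‖x - x₀‖ < 1`, the derivative integrand is dominated by a Gaussian
centred at `x₀` times `‖f‖`, integrable by `integrable_gaussian_smul_of_memLp`.
Evans, *PDE*, §2.3.1, Theorem 1; Giga–Giga–Saal, *Nonlinear PDEs*, §1.1.3. [folklore] -/
theorem hasFDerivAt_heatExtension [CompleteSpace F] {f : E → F} {p : ℝ≥0∞} (hf : MemLp f p volume)
    (hp : 1 ≤ p) {t : ℝ} (ht : 0 < t) (x₀ : E) :
    HasFDerivAt (heatExtension f t)
      (∫ y, (fderiv ℝ (heatKernel t) (x₀ - y)).smulRight (f y)) x₀ := by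
  have hswap : heatExtension f t = fun x => ∫ y, heatKernel t (x - y) • f y := by
    funext x
    exact convolution_lsmul_swap (𝕜 := ℝ)
  rw [hswap]
  set n : ℝ := (Module.finrank ℝ E : ℝ) with hn
  set c : ℝ := (4 * π * t) ^ (-n / 2) * (Real.sqrt t)⁻¹ with hc
  have hc0 : 0 ≤ c := by positivity
  set C₁ : ℝ := c * Real.exp (1 / (8 * t)) with hC₁
  have hK : ∀ z, HasFDerivAt (heatKernel (E := E) t) (fderiv ℝ (heatKernel t) z) z := fun z =>
    (hasFDerivAt_heatKernel t z).differentiableAt.hasFDerivAt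
  refine hasFDerivAt_integral_of_dominated_of_fderiv_le (𝕜 := ℝ) (μ := volume)
    (F := fun x y => heatKernel t (x - y) • f y)
    (F' := fun x y => (fderiv ℝ (heatKernel t) (x - y)).smulRight (f y))
    (Metric.ball_mem_nhds x₀ zero_lt_one)
    (bound := fun y => C₁ * Real.exp (-(1 / (16 * t)) * ‖x₀ - y‖ ^ 2) * ‖f y‖) ?_ ?_ ?_ ?_ ?_ ?_
  · -- measurability of the integrand near `x₀`
    exact Eventually.of_forall fun x =>
      ((continuous_heatKernel t).comp (continuous_const.sub continuous_id)).aestronglyMeasurable.smul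
        hf.1
  · -- integrability of the integrand at `x₀`
    have hb : 0 < 1 / (4 * t) := by positivity
    have := (integrable_gaussian_smul_of_memLp hb x₀ hf hp).smul
      ((4 * π * t) ^ (-(Module.finrank ℝ E : ℝ) / 2))
    refine this.congr (Eventually.of_forall fun y => ?_)
    simp only [Pi.smul_apply, heatKernel_eq, smul_smul]
  · -- measurability of the derivative integrand
    have h1 : AEStronglyMeasurable (fun y => fderiv ℝ (heatKernel t) (x₀ - y)) volume :=
      ((continuous_fderiv_heatKernel t).comp (continuous_const.sub continuous_id)).aestronglyMeasurable
    exact (ContinuousLinearMap.smulRightL ℝ E F).aestronglyMeasurable_comp₂ h1 hf.1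
  · -- domination on the unit ball around `x₀`
    refine Eventually.of_forall fun y x hx => ?_
    rw [ContinuousLinearMap.norm_smulRight_apply]
    refine mul_le_mul_of_nonneg_right ?_ (norm_nonneg _)
    refine (norm_fderiv_heatKernel_le ht (x - y)).trans ?_
    rw [hC₁, hc, hn, mul_assoc (_ * _)]
    refine mul_le_mul_of_nonneg_left ?_ hc0
    rw [← Real.exp_add]
    refine Real.exp_le_exp.2 ?_
    have hx' : ‖x₀ - x‖ < 1 := by rwa [Metric.mem_ball, dist_eq_norm, norm_sub_rev] at hx
    have htri : ‖x₀ - y‖ ≤ ‖x - y‖ + ‖x₀ - x‖ := by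
      calc ‖x₀ - y‖ = ‖(x₀ - x) + (x - y)‖ := by rw [sub_add_sub_cancel]
        _ ≤ ‖x₀ - x‖ + ‖x - y‖ := norm_add_le _ _
        _ = ‖x - y‖ + ‖x₀ - x‖ := add_comm _ _
    have hsq : ‖x₀ - y‖ ^ 2 ≤ 2 * ‖x - y‖ ^ 2 + 2 := by
      nlinarith [norm_nonneg (x₀ - y), norm_nonneg (x - y), norm_nonneg (x₀ - x),
        sq_nonneg (‖x - y‖ - ‖x₀ - x‖)]
    have h16 : 0 < 1 / (16 * t) := by positivity
    have e1 : -(1 / (8 * t)) * ‖x - y‖ ^ 2 = (1 / (16 * t)) * (-2 * ‖x - y‖ ^ 2) := by ring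
    have e2 : 1 / (8 * t) + -(1 / (16 * t)) * ‖x₀ - y‖ ^ 2 =
        (1 / (16 * t)) * (2 - ‖x₀ - y‖ ^ 2) := by ring
    rw [e1, e2]
    exact mul_le_mul_of_nonneg_left (by linarith) h16.le
  · -- integrability of the bound
    have hb : 0 < 1 / (16 * t) := by positivity
    have := (integrable_gaussian_smul_of_memLp hb x₀ hf.norm hp).const_mul C₁
    refine this.congr (Eventually.of_forall fun y => ?_)
    simp only [smul_eq_mul, mul_assoc]
  · -- pointwise differentiability
    refine Eventually.of_forall fun y x _ => ?_
    exact ((hasFDerivAt_comp_sub y).2 (hK (x - y))).smul_const (f y)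

/-- The gradient of the caloric extension of `f ∈ L^p`, `1 ≤ p ≤ ∞`, `0 < t`, as a function:
`∇(e^{tΔ}f)(x) = ∫ ∇G_t(x - y) ⊗ f(y) dy`. [folklore] -/
theorem fderiv_heatExtension_eq [CompleteSpace F] {f : E → F} {p : ℝ≥0∞} (hf : MemLp f p volume)
    (hp : 1 ≤ p) {t : ℝ} (ht : 0 < t) :
    fderiv ℝ (heatExtension f t) =
      fun x => ∫ y, (fderiv ℝ (heatKernel t) (x - y)).smulRight (f y) :=
  funext fun x => (hasFDerivAt_heatExtension hf hp ht x).fderiv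

/-- Pointwise domination of the gradient of `e^{tΔ} f` by the scalar convolution
`‖∇G_t‖ ⋆ ‖f‖`: `‖∇(e^{tΔ}f)(x)‖ ≤ ∫ ‖∇G_t(y)‖ ‖f(x - y)‖ dy`. [folklore] -/
theorem norm_fderiv_heatExtension_le [CompleteSpace F] {f : E → F} {p : ℝ≥0∞}
    (hf : MemLp f p volume) (hp : 1 ≤ p) {t : ℝ} (ht : 0 < t) (x : E) :
    ‖fderiv ℝ (heatExtension f t) x‖ ≤
      ((fun y => ‖fderiv ℝ (heatKernel t) y‖) ⋆[ContinuousLinearMap.lsmul ℝ ℝ, volume]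
        (fun y => ‖f y‖)) x := by
  rw [fderiv_heatExtension_eq hf hp ht, convolution_lsmul_swap (𝕜 := ℝ)]
  refine (norm_integral_le_integral_norm _).trans_eq ?_
  congr 1
  funext y
  rw [ContinuousLinearMap.norm_smulRight_apply, smul_eq_mul]

/-- Discharge of `eLpNorm_fderiv_heatExtension_le`, with constant `C = 2^{n/2}`:
`‖∇e^{tΔ} f‖_p ≤ ‖(‖∇G_t‖ ⋆ ‖f‖)‖_p ≤ ‖∇G_t‖₁ ‖f‖_p ≤ 2^{n/2} t^{-1/2} ‖f‖_p` for `1 ≤ p ≤ ∞`,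
`0 < t` (differentiation under the integral sign, Young's inequality `L¹ × Lᵖ → Lᵖ`, and the
Gaussian bound for `‖∇G_t‖₁`). Giga–Giga–Saal, *Nonlinear PDEs*, §1.1.3 (derivative estimates for
the heat semigroup, case `|α| = 1`, `q = p`). [cite: GigaGigaSaal2010, §1.1.3] -/
theorem eLpNorm_fderiv_heatExtension_le_holds : eLpNorm_fderiv_heatExtension_le E F := by
  intro _ p hp
  refine ⟨NNReal.mk ((2 : ℝ) ^ ((Module.finrank ℝ E : ℝ) / 2)) (by positivity), fun f hf t ht => ?_⟩
  have hKm : AEStronglyMeasurable (fun y => ‖fderiv ℝ (heatKernel (E := E) t) y‖) volume :=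
    (continuous_fderiv_heatKernel t).norm.aestronglyMeasurable
  calc eLpNorm (fderiv ℝ (heatExtension f t)) p volume
      ≤ eLpNorm ((fun y => ‖fderiv ℝ (heatKernel t) y‖) ⋆[ContinuousLinearMap.lsmul ℝ ℝ, volume]
          (fun y => ‖f y‖)) p volume :=
        eLpNorm_mono fun x => (norm_fderiv_heatExtension_le hf hp ht x).trans (Real.le_norm_self _)
    _ ≤ (∫⁻ y, ‖‖fderiv ℝ (heatKernel t) y‖‖ₑ) * eLpNorm (fun y => ‖f y‖) p volume :=
        eLpNorm_convolution_le_lintegral_enorm_mul hKm hf.1.norm hp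
    _ = (∫⁻ y, ‖fderiv ℝ (heatKernel (E := E) t) y‖ₑ) * eLpNorm f p volume := by
        rw [eLpNorm_norm]
        simp_rw [enorm_norm]
    _ ≤ ENNReal.ofReal ((2 : ℝ) ^ ((Module.finrank ℝ E : ℝ) / 2) * t ^ (-(1 / 2 : ℝ))) *
          eLpNorm f p volume := by
        gcongr
        exact lintegral_enorm_fderiv_heatKernel_le ht
    _ = _ := by
        rw [ENNReal.ofReal_mul (by positivity), ENNReal.ofReal_eq_coe_nnreal (by positivity)]

end Extension

end Literature.Analysis.UnboundedOperators
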